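import Mathlib
import HarnessLib

/-!
# The normal-frame chart adapted to an almost complex structure along an axis (Wendl 2020, §B.2.3)

Flat model, dimension four. Let `J` be a smooth almost complex structure on an open
`V ⊆ ℂ × ℂ` containing `0` with `J(0) (0,1) = (0,i)` (e.g. `J(0) = i`). Put `e₂ = (0,1)` and

  `Ξ(q, w) = (q, Re w) + Im w • J(q,0) e₂`.

Then `Ξ(q,0) = (q,0)`, `DΞ(0) = 𝟙`, so `Ξ` is a smooth local diffeomorphism at `0`
(`chart`, an `OpenPartialHomeomorph` with `⇑chart = Ξ`), and the pulled-back structure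

  `J₁(x) = DΞ(x)⁻¹ ∘ J(Ξ x) ∘ DΞ(x)`

is smooth near `0`, squares to `-1`, and is STANDARD ON NORMAL VECTORS AT AXIS POINTS:

  `J₁(q, 0) (0, w) = (0, i w)`       (`normalFrame_pullback_axis`).

This is the part of condition (3) of Wendl 2020, §B.2.3 ("`J(z,0) = i`") that the proof of the
local representation formula actually uses for the ROTATION comparison (Lemma B.32 only needs
`X_w(z,0) = (0,w)`, i.e. `J(z,0)e₂ = (0,i)`); unlike the full condition it needs no `J`-holomorphic
disc through `0`, only this explicit normal-frame chart. Brick B3a of the blueprint for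
`Literature.Geometry.Symplectic.jHolomorphic_localBranchDichotomy` (see
`Literature/Geometry/Symplectic/JHolomorphicKthRootNormalForm.lean`).

Everything is proved; no named facts.

## References

* C. Wendl, *Lectures on Contact 3-Manifolds, Holomorphic Curves and Intersection Theory*,
  Cambridge Tracts in Math. 220 (2020), App. B, §B.2.3 (conditions (1)–(3)), Lemma B.32. [Wendl2020]
* M. Micallef, B. White, *The structure of branch points in minimal surfaces and in
  pseudoholomorphic curves*, Ann. of Math. 141 (1995), §6. [MicallefWhite1995]
-/

noncomputable section

open scoped ContDiff Topology
open Set Filter Metric Function Complex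

namespace Literature.Geometry.Symplectic.NormalFrameChart

variable (J : ℂ × ℂ → ℂ × ℂ →L[ℝ] ℂ × ℂ)

/-- The normal-frame chart inverse `Ξ(q, w) = (q, Re w) + Im w • J(q,0)(0,1)`.
[cite: Wendl2020, App. B, §B.2.3] -/
def Xi (x : ℂ × ℂ) : ℂ × ℂ := (x.1, (x.2.re : ℂ)) + x.2.im • J (x.1, 0) (0, 1)

/-- Unfolding `Ξ`. [folklore] -/
theorem Xi_apply (x : ℂ × ℂ) : Xi J x = (x.1, (x.2.re : ℂ)) + x.2.im • J (x.1, 0) (0, 1) := rfl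

/-- `Ξ(q,0) = (q,0)`. [folklore] -/
@[simp] theorem Xi_axis (q : ℂ) : Xi J (q, 0) = (q, 0) := by simp [Xi]

/-- `Ξ(0) = 0`. [folklore] -/
@[simp] theorem Xi_zero : Xi J 0 = 0 := by
  rw [show (0 : ℂ × ℂ) = ((0 : ℂ), (0 : ℂ)) from rfl, Xi_axis]

/-- `Ξ` is smooth where `J(q,0)` is. [folklore] -/
theorem contDiffOn_Xi {V : Set (ℂ × ℂ)} (hJ : ContDiffOn ℝ ∞ J V) :
    ContDiffOn ℝ ∞ (Xi J) {x : ℂ × ℂ | (x.1, (0 : ℂ)) ∈ V} := by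
  have h1 : ContDiff ℝ ∞ fun x : ℂ × ℂ => ((x.1, (x.2.re : ℂ)) : ℂ × ℂ) :=
    contDiff_fst.prodMk (ofRealCLM.contDiff.comp (reCLM.contDiff.comp contDiff_snd))
  have h2 : ContDiff ℝ ∞ fun x : ℂ × ℂ => x.2.im := imCLM.contDiff.comp contDiff_snd
  have h3 : ContDiffOn ℝ ∞ (fun x : ℂ × ℂ => J (x.1, 0) (0, 1)) {x : ℂ × ℂ | (x.1, (0 : ℂ)) ∈ V} :=
    (hJ.comp (contDiff_fst.prodMk contDiff_const).contDiffOn fun x hx => hx).clm_apply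
      contDiffOn_const
  exact h1.contDiffOn.add (h2.contDiffOn.smul h3)

/-- The set `{x | (x.1, 0) ∈ V}` is open. [folklore] -/
theorem isOpen_axisPreimage {V : Set (ℂ × ℂ)} (hV : IsOpen V) :
    IsOpen {x : ℂ × ℂ | (x.1, (0 : ℂ)) ∈ V} :=
  hV.preimage (continuous_fst.prodMk continuous_const)

/-- The derivative of `Ξ` at `0` is the identity (given `J(0)(0,1) = (0,i)`).
[cite: Wendl2020, App. B, §B.2.3] -/
theorem hasFDerivAt_Xi_zero {V : Set (ℂ × ℂ)} (hV : IsOpen V) (h0 : (0 : ℂ × ℂ) ∈ V)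
    (hJ : ContDiffOn ℝ ∞ J V) (hJ0 : J 0 (0, 1) = (0, I)) :
    HasFDerivAt (Xi J) (ContinuousLinearMap.id ℝ (ℂ × ℂ)) 0 := by
  -- the linear part
  set A : ℂ × ℂ →L[ℝ] ℂ × ℂ :=
    (ContinuousLinearMap.fst ℝ ℂ ℂ).prod
      (ofRealCLM.comp (reCLM.comp (ContinuousLinearMap.snd ℝ ℂ ℂ))) with hA
  have hA_apply : ∀ x : ℂ × ℂ, A x = (x.1, (x.2.re : ℂ)) := fun x => rfl
  -- the frame part
  set G : ℂ × ℂ → ℂ × ℂ := fun x => J (x.1, 0) (0, 1) with hG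
  have hG0 : G 0 = (0, I) := by simp only [hG, Prod.fst_zero, Prod.mk_zero_zero, hJ0]
  have hGd : DifferentiableAt ℝ G 0 := by
    have hin : DifferentiableAt ℝ (fun x : ℂ × ℂ => ((x.1, 0) : ℂ × ℂ)) 0 :=
      differentiableAt_fst.prodMk (differentiableAt_const _)
    have hJd0 : DifferentiableAt ℝ J 0 :=
      (hJ.differentiableOn (by simp)).differentiableAt (hV.mem_nhds h0)
    have hJd : DifferentiableAt ℝ J ((fun x : ℂ × ℂ => ((x.1, 0) : ℂ × ℂ)) 0) := by
      simpa only [Prod.fst_zero, Prod.mk_zero_zero] using hJd0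
    have h1 : DifferentiableAt ℝ (fun x : ℂ × ℂ => J (x.1, 0)) 0 :=
      DifferentiableAt.comp (g := J) (f := fun x : ℂ × ℂ => ((x.1, 0) : ℂ × ℂ)) 0 hJd hin
    exact h1.clm_apply (differentiableAt_const _)
  set c : ℂ × ℂ →L[ℝ] ℝ := imCLM.comp (ContinuousLinearMap.snd ℝ ℂ ℂ) with hc
  have hcd : HasFDerivAt (fun x : ℂ × ℂ => x.2.im) c 0 := c.hasFDerivAt
  have hS : HasFDerivAt (fun x : ℂ × ℂ => x.2.im • G x)
      ((0 : ℂ × ℂ).2.im • fderiv ℝ G 0 + c.smulRight (G 0)) 0 := hcd.smul hGd.hasFDerivAt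
  have hsum := A.hasFDerivAt.add hS
  have heq : A + ((0 : ℂ × ℂ).2.im • fderiv ℝ G 0 + c.smulRight (G 0)) =
      ContinuousLinearMap.id ℝ (ℂ × ℂ) := by
    refine ContinuousLinearMap.ext fun x => ?_
    obtain ⟨q, w⟩ := x
    simp [hA_apply, hG0, hc, real_smul, re_add_im]
  rw [← heq]
  exact hsum

/-- The derivative of `Ξ` at an axis point on normal vectors:
`DΞ(q,0)(0,w) = Re w • (0,1) + Im w • J(q,0)(0,1)`. [folklore] -/
theorem fderiv_Xi_axis_normal {q : ℂ} (hd : DifferentiableAt ℝ (Xi J) (q, 0)) (w : ℂ) :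
    fderiv ℝ (Xi J) (q, 0) (0, w) = w.re • ((0 : ℂ), (1 : ℂ)) + w.im • J (q, 0) (0, 1) := by
  -- the slice `w ↦ Ξ(q, w)` is affine
  set cq : ℂ × ℂ := J (q, 0) (0, 1) with hcq
  set L : ℂ →L[ℝ] ℂ × ℂ :=
    (reCLM : ℂ →L[ℝ] ℝ).smulRight (((0 : ℂ), (1 : ℂ)) : ℂ × ℂ) + (imCLM : ℂ →L[ℝ] ℝ).smulRight cq
    with hL
  have hslice : (fun w : ℂ => Xi J (q, w)) = fun w => ((q, 0) : ℂ × ℂ) + L w := by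
    funext w
    simp only [Xi_apply, hL, add_apply, ContinuousLinearMap.smulRight_apply,
      reCLM_apply, imCLM_apply, hcq]
    ext <;> simp [real_smul]
  have h1 : HasFDerivAt (fun w : ℂ => Xi J (q, w)) L 0 := by
    rw [hslice]; exact L.hasFDerivAt.const_add _
  have h2 : HasFDerivAt (fun w : ℂ => Xi J (q, w))
      ((fderiv ℝ (Xi J) (q, 0)).comp (ContinuousLinearMap.inr ℝ ℂ ℂ)) 0 :=
    hd.hasFDerivAt.comp (0 : ℂ) (hasFDerivAt_prodMk_right (𝕜 := ℝ) q (0 : ℂ))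
  have := congrArg (fun T : ℂ →L[ℝ] ℂ × ℂ => T w) (h2.unique h1)
  simpa [hL] using this

/-- `J(q,0)` acts on `DΞ(q,0)(0,w)` as multiplication by `i` on `w`.
[cite: Wendl2020, App. B, §B.2.3 and Lemma B.32] -/
theorem J_fderiv_Xi_axis_normal {q : ℂ} (hd : DifferentiableAt ℝ (Xi J) (q, 0))
    (hJ2 : ∀ v, J (q, 0) (J (q, 0) v) = -v) (w : ℂ) :
    J (q, 0) (fderiv ℝ (Xi J) (q, 0) (0, w)) = fderiv ℝ (Xi J) (q, 0) (0, I * w) := by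
  rw [fderiv_Xi_axis_normal J hd, fderiv_Xi_axis_normal J hd, map_add, map_smul, map_smul, hJ2]
  simp only [mul_re, I_re, zero_mul, I_im, one_mul, zero_sub, mul_im, smul_neg, neg_smul]
  abel

/-! ### The pulled-back structure and the chart -/

/-- The pulled-back structure `J₁(x) = DΞ(x)⁻¹ ∘ J(Ξ x) ∘ DΞ(x)` (where `DΞ(x)` is invertible).
[cite: Wendl2020, App. B, §B.2.3] -/
def pullback (x : ℂ × ℂ) : ℂ × ℂ →L[ℝ] ℂ × ℂ :=
  Ring.inverse (fderiv ℝ (Xi J) x) * (J (Xi J x) * fderiv ℝ (Xi J) x)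

/-- Unfolding `pullback`. [folklore] -/
theorem pullback_apply (x v : ℂ × ℂ) :
    pullback J x v = Ring.inverse (fderiv ℝ (Xi J) x) (J (Xi J x) (fderiv ℝ (Xi J) x v)) := rfl

/-- The inverse of the automorphism attached to a unit is the inverse unit. [folklore] -/
theorem unitsEquiv_symm_apply {M : Type*} [NormedAddCommGroup M] [NormedSpace ℝ M]
    (u : (M →L[ℝ] M)ˣ) (v : M) :
    (ContinuousLinearEquiv.unitsEquiv ℝ M u).symm v = ((u⁻¹ : (M →L[ℝ] M)ˣ) : M →L[ℝ] M) v := by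
  rw [← ContinuousLinearEquiv.unitsEquiv_apply, map_inv]; rfl

/-- The automorphism attached to a unit, as a continuous linear map. [folklore] -/
theorem coe_unitsEquiv {M : Type*} [NormedAddCommGroup M] [NormedSpace ℝ M] (u : (M →L[ℝ] M)ˣ) :
    ((ContinuousLinearEquiv.unitsEquiv ℝ M u : M ≃L[ℝ] M) : M →L[ℝ] M) = (u : M →L[ℝ] M) := by
  ext v; simp

variable {J}

/-- **The normal-frame chart (flat model).** See the module docstring: `Θ₁ = Ξ⁻¹` near `0` is a
smooth local diffeomorphism fixing `0` with `DΘ₁(0) = 𝟙`; the structure `J₁ = Θ₁_* J`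
(`pullback J`) is smooth, squares to `-1`, intertwines with `J` under `DΘ₁`, and satisfies
`J₁(q,0)(0,w) = (0, iw)` along the axis.
[cite: Wendl2020, App. B, §B.2.3, conditions (1)–(3) and Lemma B.32] -/
theorem exists_normalFrameChart {V : Set (ℂ × ℂ)} (hV : IsOpen V) (h0 : (0 : ℂ × ℂ) ∈ V)
    (hJ : ContDiffOn ℝ ∞ J V) (hJ2 : ∀ x ∈ V, ∀ v, J x (J x v) = -v) (hJ0 : J 0 (0, 1) = (0, I)) :
    ∃ (Θ₁ : OpenPartialHomeomorph (ℂ × ℂ) (ℂ × ℂ)) (r : ℝ), 0 < r ∧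
      (0 : ℂ × ℂ) ∈ Θ₁.source ∧ Θ₁ 0 = 0 ∧ ContDiffOn ℝ ∞ Θ₁ Θ₁.source ∧
      ContDiffOn ℝ ∞ Θ₁.symm Θ₁.target ∧ fderiv ℝ Θ₁ 0 = ContinuousLinearMap.id ℝ (ℂ × ℂ) ∧
      Θ₁.source ⊆ V ∧ (∀ x', Θ₁.symm x' = Xi J x') ∧
      ContDiffOn ℝ ∞ (pullback J) Θ₁.target ∧
      (∀ x' ∈ Θ₁.target, ∀ v, pullback J x' (pullback J x' v) = -v) ∧
      (∀ x ∈ Θ₁.source, ∀ v, pullback J (Θ₁ x) (fderiv ℝ Θ₁ x v) = fderiv ℝ Θ₁ x (J x v)) ∧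
      (∀ q : ℂ, ‖q‖ < r → (q, (0 : ℂ)) ∈ Θ₁.target ∧ ∀ w, pullback J (q, 0) (0, w) = (0, I * w)) := by
  -- the open set where everything is nice
  set W₁ : Set (ℂ × ℂ) := {x : ℂ × ℂ | (x.1, (0 : ℂ)) ∈ V} with hW₁
  have hW₁o : IsOpen W₁ := isOpen_axisPreimage hV
  have h0W₁ : (0 : ℂ × ℂ) ∈ W₁ := by
    show ((0 : ℂ × ℂ).1, (0 : ℂ)) ∈ V
    rw [show ((0 : ℂ × ℂ).1, (0 : ℂ)) = (0 : ℂ × ℂ) from rfl]; exact h0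
  have hXi : ContDiffOn ℝ ∞ (Xi J) W₁ := contDiffOn_Xi J hJ
  set D : ℂ × ℂ → (ℂ × ℂ →L[ℝ] ℂ × ℂ) := fderiv ℝ (Xi J) with hD
  have hDsmooth : ContDiffOn ℝ ∞ D W₁ := hXi.fderiv_of_isOpen hW₁o (by simp)
  have hderiv0 : HasFDerivAt (Xi J) (ContinuousLinearMap.id ℝ (ℂ × ℂ)) 0 :=
    hasFDerivAt_Xi_zero J hV h0 hJ hJ0
  have hD0 : D 0 = 1 := hderiv0.fderiv
  set W : Set (ℂ × ℂ) := W₁ ∩ (Xi J) ⁻¹' V ∩ D ⁻¹' (ball (1 : ℂ × ℂ →L[ℝ] ℂ × ℂ) 1) with hW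
  have hWo : IsOpen W := by
    refine ContinuousOn.isOpen_inter_preimage ?_ (hXi.continuousOn.isOpen_inter_preimage hW₁o hV)
      isOpen_ball
    exact hDsmooth.continuousOn.mono inter_subset_left
  have h0W : (0 : ℂ × ℂ) ∈ W := by
    refine ⟨⟨h0W₁, ?_⟩, ?_⟩
    · show Xi J 0 ∈ V; rw [Xi_zero]; exact h0
    · show D 0 ∈ ball (1 : ℂ × ℂ →L[ℝ] ℂ × ℂ) 1; rw [hD0]; exact mem_ball_self one_pos
  obtain ⟨δ, hδ, hδW⟩ := Metric.isOpen_iff.1 hWo 0 h0W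
  -- units
  have hunit : ∀ x ∈ W, ∃ u : (ℂ × ℂ →L[ℝ] ℂ × ℂ)ˣ, (u : ℂ × ℂ →L[ℝ] ℂ × ℂ) = D x := by
    intro x hx
    have h1 : ‖(1 : ℂ × ℂ →L[ℝ] ℂ × ℂ) - D x‖ < 1 := by
      rw [← dist_eq_norm, dist_comm]; exact hx.2
    exact ⟨Units.oneSub _ h1, by rw [Units.val_oneSub, sub_sub_cancel]⟩
  have hderiv : ∀ x ∈ W, HasFDerivAt (Xi J) (D x) x := fun x hx =>
    ((hXi.differentiableOn (by simp)).differentiableAt (hW₁o.mem_nhds hx.1.1)).hasFDerivAt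
  -- the chart
  set E : OpenPartialHomeomorph (ℂ × ℂ) (ℂ × ℂ) :=
    (hXi.contDiffAt (hW₁o.mem_nhds h0W₁)).toOpenPartialHomeomorph (Xi J)
      (f' := ContinuousLinearEquiv.refl ℝ (ℂ × ℂ)) (by simpa using hderiv0) (by simp) with hE
  have hEcoe : (E : ℂ × ℂ → ℂ × ℂ) = Xi J := rfl
  have h0E : (0 : ℂ × ℂ) ∈ E.source :=
    (hXi.contDiffAt (hW₁o.mem_nhds h0W₁)).mem_toOpenPartialHomeomorph_source
      (f' := ContinuousLinearEquiv.refl ℝ (ℂ × ℂ)) (by simpa using hderiv0) (by simp)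
  set E' : OpenPartialHomeomorph (ℂ × ℂ) (ℂ × ℂ) := E.restrOpen (ball 0 δ) isOpen_ball with hE'
  have hE'coe : (E' : ℂ × ℂ → ℂ × ℂ) = Xi J := rfl
  have hE'src : E'.source = E.source ∩ ball 0 δ := rfl
  have hE'W : E'.source ⊆ W := fun x hx => hδW hx.2
  have h0E' : (0 : ℂ × ℂ) ∈ E'.source := ⟨h0E, mem_ball_self hδ⟩
  set Θ₁ := E'.symm with hΘ₁
  have hΘ₁tgt : Θ₁.target = E'.source := rfl
  have hΘ₁src : Θ₁.source = E'.target := rfl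
  have h0t : (0 : ℂ × ℂ) ∈ Θ₁.source := by
    rw [hΘ₁src, ← Xi_zero J, ← hE'coe]; exact E'.map_source h0E'
  have hΘ₁0 : Θ₁ 0 = 0 := by
    have := E'.left_inv h0E'
    rwa [hE'coe, Xi_zero] at this
  -- smoothness of `Θ₁`
  have hΘ₁_at : ∀ a ∈ Θ₁.source, ContDiffAt ℝ ∞ Θ₁ a ∧
      ∃ u : (ℂ × ℂ →L[ℝ] ℂ × ℂ)ˣ, (u : ℂ × ℂ →L[ℝ] ℂ × ℂ) = D (Θ₁ a) ∧
        HasFDerivAt Θ₁ ((ContinuousLinearEquiv.unitsEquiv ℝ _ u).symm : ℂ × ℂ →L[ℝ] ℂ × ℂ) a := by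
    intro a ha
    have hy : Θ₁ a ∈ E'.source := E'.map_target ha
    obtain ⟨u, hu⟩ := hunit _ (hE'W hy)
    have hd : HasFDerivAt E' ((ContinuousLinearEquiv.unitsEquiv ℝ _ u : (ℂ × ℂ) ≃L[ℝ] ℂ × ℂ) :
        ℂ × ℂ →L[ℝ] ℂ × ℂ) (E'.symm a) := by
      rw [coe_unitsEquiv, hu, hE'coe]; exact hderiv _ (hE'W hy)
    refine ⟨E'.contDiffAt_symm ha hd ?_, u, hu, E'.hasFDerivAt_symm ha hd⟩
    rw [hE'coe]; exact hXi.contDiffAt (hW₁o.mem_nhds (hE'W hy).1.1)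
  have hΘ₁smooth : ContDiffOn ℝ ∞ Θ₁ Θ₁.source := fun a ha => (hΘ₁_at a ha).1.contDiffWithinAt
  have hfdΘ₁ : ∀ a ∈ Θ₁.source, ∀ v, fderiv ℝ Θ₁ a v = Ring.inverse (D (Θ₁ a)) v := by
    intro a ha v
    obtain ⟨-, u, hu, hd⟩ := hΘ₁_at a ha
    rw [hd.fderiv, ContinuousLinearEquiv.coe_coe, unitsEquiv_symm_apply, ← hu, Ring.inverse_unit]
  obtain ⟨r, hr, hrE⟩ := Metric.isOpen_iff.1 E'.open_source 0 h0E'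
  refine ⟨Θ₁, r, hr, h0t, hΘ₁0, hΘ₁smooth, ?_, ?_, ?_, fun x' => rfl, ?_, ?_, ?_, ?_⟩
  · -- `Θ₁.symm = Ξ` smooth on the target
    rw [hΘ₁tgt]
    exact hXi.mono fun x hx => (hE'W hx).1.1
  · -- `DΘ₁(0) = 𝟙`
    obtain ⟨-, u, hu, hd⟩ := hΘ₁_at 0 h0t
    rw [hd.fderiv]
    have hu1 : u = 1 := Units.ext (by rw [hu, hΘ₁0, hD0, Units.val_one])
    subst hu1
    refine ContinuousLinearMap.ext fun v => ?_
    rw [ContinuousLinearEquiv.coe_coe, unitsEquiv_symm_apply, inv_one, Units.val_one]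
    rfl
  · -- `Θ₁.source ⊆ V`
    intro x hx
    have hy : Θ₁ x ∈ E'.source := E'.map_target hx
    have := (hE'W hy).1.2
    simp only [mem_preimage] at this
    rwa [← hE'coe, show E' (Θ₁ x) = x from E'.right_inv hx] at this
  · -- smoothness of the pulled-back structure on `Θ₁.target = E'.source ⊆ W`
    rw [hΘ₁tgt]
    have hWs : E'.source ⊆ W₁ := fun x hx => (hE'W hx).1.1
    have h1 : ContDiffOn ℝ ∞ (fun x => Ring.inverse (D x)) E'.source := by
      intro x hx
      obtain ⟨u, hu⟩ := hunit x (hE'W hx)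
      have hri : ContDiffAt ℝ ∞ Ring.inverse (D x) := hu ▸ contDiffAt_ringInverse ℝ u
      exact hri.comp_contDiffWithinAt x ((hDsmooth.mono hWs) x hx)
    have h2 : ContDiffOn ℝ ∞ (fun x => J (Xi J x)) E'.source :=
      hJ.comp (hXi.mono hWs) fun x hx => (hE'W hx).1.2
    exact h1.mul (h2.mul (hDsmooth.mono hWs))
  · -- `J₁² = -1`
    intro x' hx' v
    obtain ⟨u, hu⟩ := hunit x' (hE'W hx')
    have hXV : Xi J x' ∈ V := (hE'W hx').1.2
    have hinv1 : ∀ w, D x' (Ring.inverse (D x') w) = w := fun w =>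
      congrArg (fun T : ℂ × ℂ →L[ℝ] ℂ × ℂ => T w) (Ring.mul_inverse_cancel _ ⟨u, hu⟩)
    have hinv2 : ∀ w, Ring.inverse (D x') (D x' w) = w := fun w =>
      congrArg (fun T : ℂ × ℂ →L[ℝ] ℂ × ℂ => T w) (Ring.inverse_mul_cancel _ ⟨u, hu⟩)
    rw [pullback_apply, pullback_apply, hinv1, hJ2 _ hXV, map_neg, hinv2]
  · -- intertwining
    intro x hx v
    have hy : Θ₁ x ∈ E'.source := E'.map_target hx
    obtain ⟨u, hu⟩ := hunit _ (hE'W hy)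
    have hXx : Xi J (Θ₁ x) = x := by rw [← hE'coe]; exact E'.right_inv hx
    have hinv1 : ∀ w, D (Θ₁ x) (Ring.inverse (D (Θ₁ x)) w) = w := fun w =>
      congrArg (fun T : ℂ × ℂ →L[ℝ] ℂ × ℂ => T w) (Ring.mul_inverse_cancel _ ⟨u, hu⟩)
    rw [pullback_apply, hfdΘ₁ x hx, hfdΘ₁ x hx, hinv1, hXx]
  · -- along the axis
    intro q hq
    have hq' : ((q, 0) : ℂ × ℂ) ∈ E'.source := by
      refine hrE ?_
      rw [mem_ball, dist_zero_right, Prod.norm_mk, norm_zero, max_eq_left (norm_nonneg _)]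
      exact hq
    refine ⟨hq', fun w => ?_⟩
    have hqW := hE'W hq'
    obtain ⟨u, hu⟩ := hunit _ hqW
    have hqV : ((q, 0) : ℂ × ℂ) ∈ V := hqW.1.1
    have hd : DifferentiableAt ℝ (Xi J) (q, 0) :=
      (hXi.differentiableOn (by simp)).differentiableAt (hW₁o.mem_nhds hqW.1.1)
    have hinv2 : ∀ w, Ring.inverse (D (q, 0)) (D (q, 0) w) = w := fun w =>
      congrArg (fun T : ℂ × ℂ →L[ℝ] ℂ × ℂ => T w) (Ring.inverse_mul_cancel _ ⟨u, hu⟩)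
    rw [pullback_apply, Xi_axis, J_fderiv_Xi_axis_normal J hd (hJ2 _ hqV), hinv2]

/-- **Transfer of `J`-holomorphicity through a chart** intertwining `J` and `Jt`
(`Jt (Θ x) ∘ DΘ(x) = DΘ(x) ∘ J x`): if `∂_y u = J(u) ∂ₓu` at `z` then
`∂_y (Θ ∘ u) = Jt(Θ ∘ u) ∂ₓ(Θ ∘ u)` at `z` (chain rule). [folklore] -/
theorem jHolomorphic_transfer {F G : Type*} [NormedAddCommGroup F] [NormedSpace ℝ F]
    [NormedAddCommGroup G] [NormedSpace ℝ G] {Θ : F → G} {J' : F → F →L[ℝ] F}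
    {Jt : G → G →L[ℝ] G} {s : Set F} (hs : IsOpen s) (hΘ : DifferentiableOn ℝ Θ s)
    (hint : ∀ x ∈ s, ∀ v, Jt (Θ x) (fderiv ℝ Θ x v) = fderiv ℝ Θ x (J' x v))
    {u : ℂ → F} {z : ℂ} (hu : DifferentiableAt ℝ u z) (hus : u z ∈ s)
    (hhol : fderiv ℝ u z I = J' (u z) (fderiv ℝ u z 1)) :
    fderiv ℝ (Θ ∘ u) z I = Jt (Θ (u z)) (fderiv ℝ (Θ ∘ u) z 1) := by
  have hΘd : DifferentiableAt ℝ Θ (u z) := hΘ.differentiableAt (hs.mem_nhds hus)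
  rw [fderiv_comp z hΘd hu, ContinuousLinearMap.comp_apply, ContinuousLinearMap.comp_apply, hhol,
    hint _ hus]

end Literature.Geometry.Symplectic.NormalFrameChart

end
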